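import Summits.CriticalPhenomena.PercolationContinuityZ3.Theorems.PercNearOneGluingNoHeavyLowerTailSahiCTCKleitmanSurplus
import HarnessLib

/-!
# `NoHeavyLowerTail` (crux stmt-CriticalPhenomena-4575), P3 lane: a STRENGTHENED KLEITMAN INEQUALITY — the surplus of two loop-free traces on a
# sub-cube dominates the number of common edges whose co-set is not a common member ("Lemma A" of memo g48)

Support file (seat `prim-l12-p3`, gen 48; `--supports stmt-CriticalPhenomena-4575`).  Memo
`run/shared/lean/prim/prim-l12/FROM-prim-l12-p3-g48-THREE-BLOCK-SLOTS.md` §2.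

Setting of `…SahiCTCKleitmanSurplus`: a sub-cube of `2^α` with base `D` and free set `s`, two up-sets `𝒳, 𝒵`, the trace `tr 𝒳 D s = {U ⊆ s : D ∪ U ∈ 𝒳}`
and the Kleitman surplus `kap 𝒳 𝒵 D s = #(tr 𝒳 ∩ tr 𝒵) − #{U ∈ tr 𝒳 : s \ U ∈ tr 𝒵} ≥ 0`.  Call the traces LOOP-FREE if `D ∪ {u}` lies in neither
family for every free `u ∈ s`; a COMMON EDGE is a 2-subset `c ⊆ s` with `D ∪ c ∈ 𝒳 ∩ 𝒵`, and it is BAD if its co-set `D ∪ (s \ c)` is not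
a common member.  THIS FILE proves
* **`card_cubeBadEdges_le_kap`** : for loop-free traces, `#{bad common edges} ≤ kap` — Kleitman's inequality `kap ≥ 0` strengthened by one unit per bad
  common edge.  This is exactly the "r-slot" inequality of the three-block form of the squarefree row of `R_3 ∈ ℕ[s]` (memo g48 §1–§2), and it implies
  the "a-slot" inequality.
Proof: induction on `#s` through the vertex recursion `kap_rec` at a vertex `v` of a common edge (of common degree ≥ 2 when possible): the link term is
`≥ 1` by `one_le_kap_of_loop`, the deletion term pays the bad edges avoiding `v` (induction), and the mixed term pays the bad edges through `v` by the
explicit doubly-pivotal witnesses `c.erase v` / `s \ c`; the only obstruction forces a single common edge, paid by the link term.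
Nothing is asserted about the crux.
-/

namespace Summit.CriticalPhenomena.PercolationContinuityZ3.Theorems.SahiCTCForms

open Finset

variable {α : Type*} [DecidableEq α]

/-! ### Common edges of the traces -/

section Edges
variable {𝒳 𝒵 : Finset (Finset α)} {D s : Finset α}

/-- Membership in the set of COMMON EDGES of the traces on the sub-cube `(D, s)` (2-subsets `c ⊆ s` with `D ∪ c ∈ 𝒳 ∩ 𝒵`). [this work] -/
theorem mem_cubeCommonEdges {c : Finset α} :
    c ∈ (s.powerset.filter fun c => #c = 2 ∧ D ∪ c ∈ 𝒳 ∧ D ∪ c ∈ 𝒵) ↔ c ⊆ s ∧ #c = 2 ∧ D ∪ c ∈ 𝒳 ∧ D ∪ c ∈ 𝒵 := by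
  rw [mem_filter, mem_powerset]

/-- Membership in the set of BAD common edges (co-set `D ∪ (s \\ c)` not a common member). [this work] -/
theorem mem_cubeBadEdges {c : Finset α} :
    c ∈ ((s.powerset.filter fun c => #c = 2 ∧ D ∪ c ∈ 𝒳 ∧ D ∪ c ∈ 𝒵).filter fun c => ¬ (D ∪ (s \ c) ∈ 𝒳 ∧ D ∪ (s \ c) ∈ 𝒵)) ↔
      c ∈ (s.powerset.filter fun c => #c = 2 ∧ D ∪ c ∈ 𝒳 ∧ D ∪ c ∈ 𝒵) ∧ ¬ (D ∪ (s \ c) ∈ 𝒳 ∧ D ∪ (s \ c) ∈ 𝒵) := by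
  rw [mem_filter]

/-- Bad common edges are common edges. [this work] -/
theorem cubeBadEdges_subset :
    ((s.powerset.filter fun c => #c = 2 ∧ D ∪ c ∈ 𝒳 ∧ D ∪ c ∈ 𝒵).filter fun c => ¬ (D ∪ (s \ c) ∈ 𝒳 ∧ D ∪ (s \ c) ∈ 𝒵))
      ⊆ (s.powerset.filter fun c => #c = 2 ∧ D ∪ c ∈ 𝒳 ∧ D ∪ c ∈ 𝒵) :=
  filter_subset _ _

/-- A common edge through `v` is `{v, w}` for a free `w ≠ v`. [this work] -/
theorem exists_pair_of_mem_cubeCommonEdges {c : Finset α} (hc : c ∈ (s.powerset.filter fun c => #c = 2 ∧ D ∪ c ∈ 𝒳 ∧ D ∪ c ∈ 𝒵))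
    {v : α} (hv : v ∈ c) :
    ∃ w, w ∈ s ∧ w ≠ v ∧ c = {v, w} := by
  obtain ⟨hcs, hc2, -, -⟩ := mem_cubeCommonEdges.1 hc
  obtain ⟨x, y, hxy, rfl⟩ := card_eq_two.1 hc2
  rcases mem_insert.1 hv with rfl | hv
  · exact ⟨y, hcs (by simp), hxy.symm, rfl⟩
  · rw [mem_singleton] at hv; subst hv
    exact ⟨x, hcs (by simp), hxy, pair_comm x v⟩

/-- For `c = {v, w}` with `w ≠ v`: `c.erase v = {w}`. [this work] -/
theorem pair_erase_left {v w : α} (hwv : w ≠ v) : ({v, w} : Finset α).erase v = {w} := by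
  ext x; simp only [mem_erase, mem_insert, mem_singleton]
  constructor
  · rintro ⟨hxv, (rfl | rfl)⟩; exact absurd rfl hxv; rfl
  · rintro rfl; exact ⟨hwv, Or.inr rfl⟩

end Edges

/-! ### Set identities for the witnesses -/

section SetId
variable {s c : Finset α} {v : α}

/-- `(s − v) \ (c − v) = s \ c` when `v ∈ c`. [this work] -/
theorem erase_sdiff_erase_eq (hv : v ∈ c) : s.erase v \ c.erase v = s \ c := by
  ext x; simp only [mem_sdiff, mem_erase]
  constructor
  · rintro ⟨⟨hxv, hxs⟩, h⟩; exact ⟨hxs, fun hxc => h ⟨hxv, hxc⟩⟩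
  · rintro ⟨hxs, hxc⟩; exact ⟨⟨fun h => hxc (h ▸ hv), hxs⟩, fun h => hxc h.2⟩

/-- `(s − v) \ (s \ c) = c − v` when `c ⊆ s`. [this work] -/
theorem erase_sdiff_sdiff_eq (hcs : c ⊆ s) : s.erase v \ (s \ c) = c.erase v := by
  ext x; simp only [mem_sdiff, mem_erase, not_and, not_not]
  constructor
  · rintro ⟨⟨hxv, hxs⟩, h⟩; exact ⟨hxv, h hxs⟩
  · rintro ⟨hxv, hxc⟩; exact ⟨⟨hxv, hcs hxc⟩, fun _ => hxc⟩

/-- `(D + v) ∪ (c − v) = D ∪ c` when `v ∈ c`. [this work] -/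
theorem insert_union_erase_eq (D : Finset α) (hv : v ∈ c) : insert v D ∪ c.erase v = D ∪ c := by
  ext x; simp only [mem_union, mem_insert, mem_erase]
  constructor
  · rintro ((rfl | hx) | ⟨_, hx⟩); exact Or.inr hv; exact Or.inl hx; exact Or.inr hx
  · rintro (hx | hx)
    · exact Or.inl (Or.inr hx)
    · by_cases hxv : x = v; exact Or.inl (Or.inl hxv); exact Or.inr ⟨hxv, hx⟩

/-- `D ∪ {w} = D + w`. [this work] -/
theorem union_singleton_eq_insert (D : Finset α) (w : α) : D ∪ {w} = insert w D := by
  rw [union_comm, ← insert_eq]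

end SetId

/-! ### The theorem -/

section Main
variable {𝒳 𝒵 : Finset (Finset α)}

/-- **LEMMA A (strengthened Kleitman inequality).**  For two up-sets whose traces on the sub-cube `(D, s)` are loop-free, the Kleitman surplus is at
least the number of common edges `c` (2-subsets of `s` with `D ∪ c` in both families) whose co-set `D ∪ (s \ c)` is not a common member. [this work] -/
theorem card_cubeBadEdges_le_kap (h𝒳 : IsUpperSet (𝒳 : Set (Finset α))) (h𝒵 : IsUpperSet (𝒵 : Set (Finset α))) :
    ∀ (n : ℕ) (s D : Finset α), #s ≤ n → Disjoint D s → (∀ u ∈ s, insert u D ∉ 𝒳) → (∀ u ∈ s, insert u D ∉ 𝒵) →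
      (#((s.powerset.filter fun c => #c = 2 ∧ D ∪ c ∈ 𝒳 ∧ D ∪ c ∈ 𝒵).filter fun c => ¬ (D ∪ (s \ c) ∈ 𝒳 ∧ D ∪ (s \ c) ∈ 𝒵)) : ℤ)
        ≤ kap 𝒳 𝒵 D s := by
  intro n
  induction n with
  | zero =>
    intro s D hs hDs _ _
    have hs0 : s = ∅ := card_eq_zero.1 (Nat.le_zero.1 hs)
    subst hs0
    have hB : (((∅ : Finset α).powerset.filter fun c => #c = 2 ∧ D ∪ c ∈ 𝒳 ∧ D ∪ c ∈ 𝒵).filter fun c => ¬ (D ∪ ((∅ : Finset α) \ c) ∈ 𝒳 ∧ D ∪ ((∅ : Finset α) \ c) ∈ 𝒵)) = ∅ := by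
      refine eq_empty_iff_forall_notMem.2 fun c hc => ?_
      obtain ⟨hcs, hc2, -⟩ := mem_cubeCommonEdges.1 (cubeBadEdges_subset hc)
      have : c = ∅ := subset_empty.1 hcs
      subst this; simp at hc2
    rw [hB, card_empty, Nat.cast_zero]
    exact kap_nonneg h𝒳 h𝒵 ∅ D hDs
  | succ n ih =>
    intro s D hs hDs hLX hLZ
    set G := (s.powerset.filter fun c => #c = 2 ∧ D ∪ c ∈ 𝒳 ∧ D ∪ c ∈ 𝒵) with hGdef
    set Bd := (G.filter fun c => ¬ (D ∪ (s \ c) ∈ 𝒳 ∧ D ∪ (s \ c) ∈ 𝒵)) with hBddef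
    -- no common edge: Kleitman
    by_cases hG : G = ∅
    · have hB : Bd = ∅ := subset_empty.1 (hG ▸ (cubeBadEdges_subset : Bd ⊆ G))
      rw [hB, card_empty, Nat.cast_zero]
      exact kap_nonneg h𝒳 h𝒵 s D hDs
    -- choose the recursion vertex `v` on a common edge `c₀`, of common degree ≥ 2 when possible
    have hchoice : ∃ v ∈ s, (∃ c₀ ∈ G, v ∈ c₀) ∧
        ((∃ c₁ ∈ G, ∃ c₂ ∈ G, c₁ ≠ c₂ ∧ v ∈ c₁ ∧ v ∈ c₂) ∨
          (∀ u ∈ s, ∀ c₁ ∈ G, ∀ c₂ ∈ G, u ∈ c₁ → u ∈ c₂ → c₁ = c₂)) := by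
      by_cases hdeg : ∃ u ∈ s, ∃ c₁ ∈ G, ∃ c₂ ∈ G, c₁ ≠ c₂ ∧ u ∈ c₁ ∧ u ∈ c₂
      · obtain ⟨u, hu, c₁, hc₁, c₂, hc₂, hne, hu1, hu2⟩ := hdeg
        exact ⟨u, hu, ⟨c₁, hc₁, hu1⟩, Or.inl ⟨c₁, hc₁, c₂, hc₂, hne, hu1, hu2⟩⟩
      · push Not at hdeg
        obtain ⟨c₀, hc₀⟩ := nonempty_iff_ne_empty.2 hG
        obtain ⟨hc₀s, hc₀2, -⟩ := mem_cubeCommonEdges.1 hc₀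
        obtain ⟨x, y, -, hxy⟩ := card_eq_two.1 hc₀2
        have hx : x ∈ c₀ := by rw [hxy]; simp
        refine ⟨x, hc₀s hx, ⟨c₀, hc₀, hx⟩, Or.inr fun u hu c₁ hc₁ c₂ hc₂ h1 h2 => ?_⟩
        by_contra hne
        exact hdeg u hu c₁ hc₁ c₂ hc₂ hne h1 |>.elim h2
    obtain ⟨v, hvs, ⟨c₀, hc₀G, hvc₀⟩, hstar⟩ := hchoice
    have hvD : v ∉ D := fun h => disjoint_left.1 hDs h hvs
    obtain ⟨w₀, hw₀s, hw₀v, hc₀eq⟩ := exists_pair_of_mem_cubeCommonEdges hc₀G hvc₀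
    obtain ⟨-, -, hc₀X, hc₀Z⟩ := mem_cubeCommonEdges.1 hc₀G
    -- the recursion
    set s' := s.erase v with hs'def
    have hs' : #s' ≤ n := by rw [hs'def, card_erase_of_mem hvs]; omega
    have hDs' : Disjoint D s' := Disjoint.mono_right (erase_subset v s) hDs
    have hDvs' : Disjoint (insert v D) s' := by
      rw [disjoint_insert_left]; exact ⟨notMem_erase v s, hDs'⟩
    rw [kap_rec h𝒳 h𝒵 hvs hvD]
    set J := ((tr 𝒳 (insert v D) s' \ tr 𝒳 D s').filter fun R =>
        s' \ R ∈ tr 𝒵 (insert v D) s' ∧ s' \ R ∉ tr 𝒵 D s') with hJdef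
    -- (i) the link term is ≥ 1 (common loop `w₀` over the base `D + v`)
    have hw₀s' : w₀ ∈ s' := mem_erase.2 ⟨hw₀v, hw₀s⟩
    have hDvw₀ : insert w₀ (insert v D) = D ∪ c₀ := by
      rw [hc₀eq]; ext x; simp only [mem_insert, mem_union, mem_singleton]; tauto
    have hT2 : 1 ≤ kap 𝒳 𝒵 (insert v D) s' :=
      one_le_kap_of_loop h𝒳 h𝒵 (hLX v hvs) (hLZ v hvs) hw₀s' (by rw [hDvw₀]; exact hc₀X) (by rw [hDvw₀]; exact hc₀Z)
    -- (ii) the deletion term pays the bad edges avoiding `v`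
    have hT1 : (#(Bd.filter fun c => v ∉ c) : ℤ) ≤ kap 𝒳 𝒵 D s' := by
      have hIH := ih s' D hs' hDs' (fun u hu => hLX u (mem_of_mem_erase hu)) (fun u hu => hLZ u (mem_of_mem_erase hu))
      refine le_trans ?_ hIH
      exact_mod_cast card_le_card fun c hc => by
        obtain ⟨hcBd, hvc⟩ := mem_filter.1 hc
        obtain ⟨hcG, hbad⟩ := mem_cubeBadEdges.1 hcBd
        obtain ⟨hcs, hc2, hcX, hcZ⟩ := mem_cubeCommonEdges.1 hcG
        have hcs' : c ⊆ s' := fun x hx => mem_erase.2 ⟨fun h => hvc (h ▸ hx), hcs hx⟩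
        have hsub : D ∪ (s' \ c) ⊆ D ∪ (s \ c) := union_subset_union Subset.rfl (sdiff_subset_sdiff (erase_subset v s) Subset.rfl)
        refine mem_cubeBadEdges.2 ⟨mem_cubeCommonEdges.2 ⟨hcs', hc2, hcX, hcZ⟩, fun h => hbad ⟨h𝒳 hsub h.1, h𝒵 hsub h.2⟩⟩
    have hT1' : 0 ≤ kap 𝒳 𝒵 D s' := kap_nonneg h𝒳 h𝒵 s' D hDs'
    have hT3' : (0 : ℤ) ≤ #J := Nat.cast_nonneg _
    have hsplit : (#Bd : ℤ) = #(Bd.filter fun c => v ∉ c) + #(Bd.filter fun c => v ∈ c) := by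
      rw [← card_filter_add_card_filter_not (s := Bd) (fun c => v ∈ c)]
      push_cast; ring
    -- facts about a common edge `c ∋ v`
    have hedge : ∀ c ∈ G, v ∈ c → ∃ w, w ∈ s ∧ w ≠ v ∧ c = {v, w} ∧ c.erase v = {w} ∧ c ⊆ s ∧
        insert v D ∪ c.erase v = D ∪ c ∧ D ∪ c.erase v = insert w D := by
      intro c hcG hvc
      obtain ⟨w, hws, hwv, hceq⟩ := exists_pair_of_mem_cubeCommonEdges hcG hvc
      have hce : c.erase v = {w} := by rw [hceq]; exact pair_erase_left hwv
      refine ⟨w, hws, hwv, hceq, hce, (mem_cubeCommonEdges.1 hcG).1, insert_union_erase_eq D hvc, ?_⟩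
      rw [hce, union_singleton_eq_insert]
    -- (iii)/(iv): good and bad edges through `v`
    by_cases hbad : ∃ c ∈ Bd, v ∈ c ∧ ¬ ((D ∪ (s \ c) ∉ 𝒵 ∧ insert v D ∪ (s \ c) ∈ 𝒵) ∨ (D ∪ (s \ c) ∉ 𝒳 ∧ insert v D ∪ (s \ c) ∈ 𝒳))
    · -- a bad edge through `v` forces a single common edge, paid by the link term
      obtain ⟨c, hcBd, hvc, hngood⟩ := hbad
      obtain ⟨hcG, hcbad⟩ := mem_cubeBadEdges.1 hcBd
      obtain ⟨w, hws, hwv, hceq, hce, hcs, hc1, hc2⟩ := hedge c hcG hvc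
      -- every common edge contains `w`
      have hallw : ∀ c' ∈ G, w ∈ c' := by
        intro c' hc'G
        by_contra hwc'
        obtain ⟨hc's, -, hc'X, hc'Z⟩ := mem_cubeCommonEdges.1 hc'G
        have hsub : D ∪ c' ⊆ insert v D ∪ (s \ c) := by
          intro x hx
          rcases mem_union.1 hx with hx | hx
          · exact mem_union_left _ (mem_insert_of_mem hx)
          · by_cases hxv : x = v
            · exact mem_union_left _ (hxv ▸ mem_insert_self v D)
            · refine mem_union_right _ (mem_sdiff.2 ⟨hc's hx, fun hxc => ?_⟩)
              rw [hceq, mem_insert, mem_singleton] at hxc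
              rcases hxc with hxc | hxc
              · exact hxv hxc
              · exact hwc' (hxc ▸ hx)
        push Not at hngood
        rcases not_and_or.1 hcbad with hX | hZ
        · exact (hngood.2 hX) (h𝒳 hsub hc'X)
        · exact (hngood.1 hZ) (h𝒵 hsub hc'Z)
      -- hence `G = {c}`
      have hGle : #Bd ≤ 1 := by
        refine le_trans (card_le_card cubeBadEdges_subset) (card_le_one.2 fun c₁ hc₁ c₂ hc₂ => ?_)
        rcases hstar with ⟨c₁', hc₁', c₂', hc₂', hne, hv1, hv2⟩ | huniq
        · -- two distinct common edges through `v` both contain `w`: impossible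
          exfalso; apply hne
          obtain ⟨w₁, -, -, h1eq, -⟩ := hedge c₁' hc₁' hv1
          obtain ⟨w₂, -, -, h2eq, -⟩ := hedge c₂' hc₂' hv2
          have hw1 : w = w₁ := by
            have := hallw c₁' hc₁'; rw [h1eq, mem_insert, mem_singleton] at this
            rcases this with h | h; exact absurd h hwv; exact h
          have hw2 : w = w₂ := by
            have := hallw c₂' hc₂'; rw [h2eq, mem_insert, mem_singleton] at this
            rcases this with h | h; exact absurd h hwv; exact h
          rw [h1eq, h2eq, ← hw1, ← hw2]
        · exact huniq w hws c₁ hc₁ c₂ hc₂ (hallw c₁ hc₁) (hallw c₂ hc₂)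
      have : (#Bd : ℤ) ≤ 1 := by exact_mod_cast hGle
      linarith
    · -- every bad edge through `v` has a witness in `J`
      push Not at hbad
      have hT3nat : #(Bd.filter fun c => v ∈ c) ≤ #J := by
        refine card_le_card_of_injOn (fun c => if D ∪ (s \ c) ∉ 𝒵 ∧ insert v D ∪ (s \ c) ∈ 𝒵 then c.erase v else s \ c)
          (fun c hc => ?_) (fun c₁ hc₁ c₂ hc₂ heq => ?_)
        · -- maps to `J`
          obtain ⟨hcBd, hvc⟩ := mem_filter.1 (Finset.mem_coe.1 hc)
          obtain ⟨hcG, hcbad⟩ := mem_cubeBadEdges.1 hcBd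
          obtain ⟨w, hws, hwv, hceq, hce, hcs, hc1, hc2⟩ := hedge c hcG hvc
          obtain ⟨-, -, hcX, hcZ⟩ := mem_cubeCommonEdges.1 hcG
          have hgood := hbad c hcBd hvc
          have hsub1 : c.erase v ⊆ s' := fun x hx => mem_erase.2 ⟨(mem_erase.1 hx).1, hcs (mem_of_mem_erase hx)⟩
          have hsub2 : s \ c ⊆ s' := fun x hx => mem_erase.2 ⟨fun h => (mem_sdiff.1 hx).2 (h ▸ hvc), (mem_sdiff.1 hx).1⟩
          refine Finset.mem_coe.2 ?_
          rw [mem_filter, mem_sdiff]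
          dsimp only
          by_cases hA : D ∪ (s \ c) ∉ 𝒵 ∧ insert v D ∪ (s \ c) ∈ 𝒵
          · rw [if_pos hA]
            refine ⟨⟨mem_tr.2 ⟨hsub1, by rw [hc1]; exact hcX⟩, fun h => hLX w hws (by rw [← hc2]; exact (mem_tr.1 h).2)⟩, ?_, ?_⟩
            · rw [erase_sdiff_erase_eq hvc]; exact mem_tr.2 ⟨hsub2, hA.2⟩
            · rw [erase_sdiff_erase_eq hvc]; exact fun h => hA.1 (mem_tr.1 h).2
          · rw [if_neg hA]
            have hB : D ∪ (s \ c) ∉ 𝒳 ∧ insert v D ∪ (s \ c) ∈ 𝒳 := hgood.resolve_left hA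
            refine ⟨⟨mem_tr.2 ⟨hsub2, hB.2⟩, fun h => hB.1 (mem_tr.1 h).2⟩, ?_, ?_⟩
            · rw [erase_sdiff_sdiff_eq hcs]; exact mem_tr.2 ⟨hsub1, by rw [hc1]; exact hcZ⟩
            · rw [erase_sdiff_sdiff_eq hcs]; exact fun h => hLZ w hws (by rw [← hc2]; exact (mem_tr.1 h).2)
        · -- injective
          obtain ⟨hc₁Bd, hvc₁⟩ := mem_filter.1 (Finset.mem_coe.1 hc₁)
          obtain ⟨hc₂Bd, hvc₂⟩ := mem_filter.1 (Finset.mem_coe.1 hc₂)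
          have hc₁G := (mem_cubeBadEdges.1 hc₁Bd).1
          have hc₂G := (mem_cubeBadEdges.1 hc₂Bd).1
          obtain ⟨w₁, hw₁s, hw₁v, hc₁eq, hc₁e, hc₁s, -, hc₁2⟩ := hedge c₁ hc₁G hvc₁
          obtain ⟨w₂, hw₂s, hw₂v, hc₂eq, hc₂e, hc₂s, -, hc₂2⟩ := hedge c₂ hc₂G hvc₂
          have key1 : ∀ c : Finset α, v ∈ c → insert v (c.erase v) = c := fun c h => insert_erase h
          have key2 : ∀ c : Finset α, c ⊆ s → s \ (s \ c) = c := fun c h => Finset.sdiff_sdiff_eq_self h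
          -- mixed case is impossible: it would make the `𝒵`-witness available for the edge sent to its co-set
          have mixed : ∀ {c c' : Finset α}, c ∈ G → c' ∈ G → v ∈ c → v ∈ c' → c ⊆ s →
              c.erase v = s \ c' → ¬ (D ∪ (s \ c') ∉ 𝒵 ∧ insert v D ∪ (s \ c') ∈ 𝒵) → False := by
            intro c c' hcG hc'G hvc hvc' hcs h hnA
            obtain ⟨w, hws, hwv, hceq, hce, -, -, hcD⟩ := hedge c hcG hvc
            obtain ⟨-, -, -, hcZ⟩ := mem_cubeCommonEdges.1 hcG
            apply hnA
            constructor
            · rw [← h, hcD]; exact hLZ w hws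
            · -- `insert v D ∪ (s \ c') = D ∪ c ∈ 𝒵`
              have : insert v D ∪ (s \ c') = D ∪ c := by
                rw [← h]; exact insert_union_erase_eq D hvc
              rw [this]; exact hcZ
          dsimp only at heq
          by_cases hA₁ : D ∪ (s \ c₁) ∉ 𝒵 ∧ insert v D ∪ (s \ c₁) ∈ 𝒵 <;>
            by_cases hA₂ : D ∪ (s \ c₂) ∉ 𝒵 ∧ insert v D ∪ (s \ c₂) ∈ 𝒵
          · rw [if_pos hA₁, if_pos hA₂] at heq
            rw [← key1 c₁ hvc₁, ← key1 c₂ hvc₂, heq]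
          · rw [if_pos hA₁, if_neg hA₂] at heq
            exact (mixed hc₁G hc₂G hvc₁ hvc₂ hc₁s heq hA₂).elim
          · rw [if_neg hA₁, if_pos hA₂] at heq
            exact (mixed hc₂G hc₁G hvc₂ hvc₁ hc₂s heq.symm hA₁).elim
          · rw [if_neg hA₁, if_neg hA₂] at heq
            rw [← key2 c₁ hc₁s, ← key2 c₂ hc₂s, heq]
      have hT3 : (#(Bd.filter fun c => v ∈ c) : ℤ) ≤ #J := by exact_mod_cast hT3nat
      rw [hsplit]
      linarith
end Main

end Summit.CriticalPhenomena.PercolationContinuityZ3.Theorems.SahiCTCForms
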